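import Summits.CriticalPhenomena.PercolationContinuityZ3.Theorems.PercNearOneGluingNoHeavyConstsMDLXJointMarkerClusterWithin
import HarnessLib

/-!
# The marker-cluster reduction `Consts.MDLXJoint ⟸ J_y`, per functional (PAPER-2 track (ii); seat `prim-consts-2`, gen 17)

builds on p205010 (kernel theorem, internal audit signed; external expert review pending).  Support file (`--supports
stmt-CriticalPhenomena-4575`); memo `run/shared/lean/prim/consts/FROM-prim-consts-2-g17-CYLINDER-DUALITY.md` §8.  No definitions, no named
facts, no sorries; standard axioms.

With `L(ω) = V(C_y[G − s])(ω)` (the marker cluster off the owner), the marker coin `A(ω) ⇔ ∃ u ∈ L(ω), s(s,u) ∈ ω ⇔ s ↔ y`, the class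
`cls(ω) = {ω' | L(ω') = L(ω), A(ω') ⇔ A(ω)}` and `h̃(ω) = μ(D ∩ {s↔z} ∩ cls(ω)) / μ(D ∩ cls(ω))` (`= ν(s↔z | L, 1_Y)` on `D`):

* `Consts.integral_markerClassCond_eq` — `∫_D h̃ = μ(D ∩ {s↔z})` (tower property over the finite partition into classes).
* `Consts.integral_mul_markerClassCond_le` — `∫_D F(C_s)·h̃ ≤ ∫_{D∩{s↔z}} F(C_s)` for monotone `F`: the class-by-class sum of
  `Consts.markerClass_condCov_nonneg` (`E_ν[Cov_ν(F, 1_Z | L, 1_Y)] ≥ 0`).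
* `Consts.mdlxJoint_of_markerBetween` — **THEOREM (the reduction, per `F`): if `μ(T∩W)·CovD(F, 1{s↔y}) ≤ μ(T)·CovD(F, h̃)` (the inequality
  `J_y(F) ≥ 0` of memo §8, in cleared-denominator form) then the `Consts.MDLXJoint` inequality holds at `F`.**  Hence a proof of `J_y ≥ 0` for all
  up-events closes `Consts.MDLXJoint`; `J_y ≥ 0` passed the exhaustive census n ≤ 7 (memo §8) and is the proposal for gen 18.
[cite: VandenbergHaggstromKahn2005, Thm. 1.3 (p. 6), §1 pp. 7–8]
-/

noncomputable section

namespace Summit.CriticalPhenomena.PercolationContinuityZ3.Theorems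

open MeasureTheory Set Literature.Probability.LatticeModels Literature.Probability.Percolation
open scoped Classical

namespace Consts

variable {V : Type*} [Fintype V]

/-- Partition of unity by marker classes: for every `ω`, summing the indicators of the classes `cls(L₀,b)`, `(L₀,b) ∈ Set V × Bool`, at `ω`
gives the value at the class of `ω`. [folklore] -/
theorem sum_markerClass_indicator (s y : V) (g : BondConfig V → ℝ) (ω : BondConfig V) :
    ∑ c : Set V × Bool, ({ω' : BondConfig V | {v : V | (openGraph (ω' \ {e : Sym2 V | s ∈ e})).Reachable y v} = c.1 ∧
        ((∃ u ∈ c.1, s(s, u) ∈ ω') ↔ (c.2 = true))}).indicator g ω = g ω := by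
  set L : Set V := {v : V | (openGraph (ω \ {e : Sym2 V | s ∈ e})).Reachable y v} with hL
  set b : Bool := decide (∃ u ∈ L, s(s, u) ∈ ω) with hb
  rw [Finset.sum_eq_single (L, b)]
  · rw [indicator_of_mem]
    refine ⟨rfl, ?_⟩
    simp only [hb, decide_eq_true_eq]
  · rintro c - hc
    rw [indicator_of_notMem]
    rintro ⟨h1, h2⟩
    apply hc
    refine Prod.ext h1.symm ?_
    show c.2 = b
    rw [hb, Bool.eq_iff_iff, decide_eq_true_iff]
    rw [← h1] at h2
    exact h2.symm
  · intro h; exact absurd (Finset.mem_univ _) h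

/-- Set integrals split over the marker classes. [folklore] -/
theorem setIntegral_eq_sum_markerClass (μ : Measure (BondConfig V)) [IsFiniteMeasure μ] (s y : V) (S : Set (BondConfig V))
    (g : BondConfig V → ℝ) :
    ∫ ω in S, g ω ∂μ = ∑ c : Set V × Bool, ∫ ω in S ∩ {ω' : BondConfig V |
        {v : V | (openGraph (ω' \ {e : Sym2 V | s ∈ e})).Reachable y v} = c.1 ∧ ((∃ u ∈ c.1, s(s, u) ∈ ω') ↔ (c.2 = true))}, g ω ∂μ := by
  have hmeas : ∀ A : Set (BondConfig V), MeasurableSet A := fun _ => MeasurableSet.of_discrete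
  have h1 : ∀ ω, S.indicator g ω = ∑ c : Set V × Bool, (S ∩ {ω' : BondConfig V |
      {v : V | (openGraph (ω' \ {e : Sym2 V | s ∈ e})).Reachable y v} = c.1 ∧ ((∃ u ∈ c.1, s(s, u) ∈ ω') ↔ (c.2 = true))}).indicator g ω := by
    intro ω
    rw [← sum_markerClass_indicator s y (S.indicator g) ω]
    refine Finset.sum_congr rfl fun c _ => ?_
    rw [indicator_indicator, inter_comm]
  rw [← integral_indicator (hmeas S), show (S.indicator g) = fun ω => ∑ c : Set V × Bool, (S ∩ {ω' : BondConfig V |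
      {v : V | (openGraph (ω' \ {e : Sym2 V | s ∈ e})).Reachable y v} = c.1 ∧ ((∃ u ∈ c.1, s(s, u) ∈ ω') ↔ (c.2 = true))}).indicator g ω
      from funext h1, integral_finsetSum _ (fun c _ => (Integrable.of_finite))]
  refine Finset.sum_congr rfl fun c _ => ?_
  rw [integral_indicator (hmeas _)]

omit [Fintype V] in
/-- On the class `cls(L₀,b)` the class of `ω` is `cls(L₀,b)`. [folklore] -/
theorem markerClass_eq_of_mem {s y : V} {ω : BondConfig V} {c : Set V × Bool}
    (hω : ω ∈ {ω' : BondConfig V | {v : V | (openGraph (ω' \ {e : Sym2 V | s ∈ e})).Reachable y v} = c.1 ∧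
        ((∃ u ∈ c.1, s(s, u) ∈ ω') ↔ (c.2 = true))}) :
    {ω' : BondConfig V | {v : V | (openGraph (ω' \ {e : Sym2 V | s ∈ e})).Reachable y v} =
          {v : V | (openGraph (ω \ {e : Sym2 V | s ∈ e})).Reachable y v} ∧
        ((∃ u ∈ {v : V | (openGraph (ω \ {e : Sym2 V | s ∈ e})).Reachable y v}, s(s, u) ∈ ω') ↔
          (∃ u ∈ {v : V | (openGraph (ω \ {e : Sym2 V | s ∈ e})).Reachable y v}, s(s, u) ∈ ω))} =
      {ω' : BondConfig V | {v : V | (openGraph (ω' \ {e : Sym2 V | s ∈ e})).Reachable y v} = c.1 ∧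
        ((∃ u ∈ c.1, s(s, u) ∈ ω') ↔ (c.2 = true))} := by
  obtain ⟨h1, h2⟩ := hω
  rw [h1, h2]

/-- **Tower property over marker classes: `∫_D h̃ = μ(D ∩ {s↔z})`.** [folklore] -/
theorem integral_markerClassCond_eq (w : Sym2 V → unitInterval) (s y z : V) (D : Set (BondConfig V)) :
    ∫ ω in D, (prodBernoulli w).real (D ∩ openConn s z ∩ {ω' : BondConfig V |
        {v : V | (openGraph (ω' \ {e : Sym2 V | s ∈ e})).Reachable y v} = {v : V | (openGraph (ω \ {e : Sym2 V | s ∈ e})).Reachable y v} ∧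
        ((∃ u ∈ {v : V | (openGraph (ω \ {e : Sym2 V | s ∈ e})).Reachable y v}, s(s, u) ∈ ω') ↔
          (∃ u ∈ {v : V | (openGraph (ω \ {e : Sym2 V | s ∈ e})).Reachable y v}, s(s, u) ∈ ω))}) /
      (prodBernoulli w).real (D ∩ {ω' : BondConfig V |
        {v : V | (openGraph (ω' \ {e : Sym2 V | s ∈ e})).Reachable y v} = {v : V | (openGraph (ω \ {e : Sym2 V | s ∈ e})).Reachable y v} ∧
        ((∃ u ∈ {v : V | (openGraph (ω \ {e : Sym2 V | s ∈ e})).Reachable y v}, s(s, u) ∈ ω') ↔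
          (∃ u ∈ {v : V | (openGraph (ω \ {e : Sym2 V | s ∈ e})).Reachable y v}, s(s, u) ∈ ω))}) ∂(prodBernoulli w) =
    (prodBernoulli w).real (D ∩ openConn s z) := by
  set μ := prodBernoulli w with hμ
  have hmeas : ∀ A : Set (BondConfig V), MeasurableSet A := fun _ => MeasurableSet.of_discrete
  rw [setIntegral_eq_sum_markerClass μ s y D]
  have hsplit : μ.real (D ∩ openConn s z) = ∑ c : Set V × Bool, μ.real (D ∩ openConn s z ∩ {ω' : BondConfig V |
      {v : V | (openGraph (ω' \ {e : Sym2 V | s ∈ e})).Reachable y v} = c.1 ∧ ((∃ u ∈ c.1, s(s, u) ∈ ω') ↔ (c.2 = true))}) := by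
    have h := setIntegral_eq_sum_markerClass μ s y (D ∩ openConn s z) (fun _ => (1 : ℝ))
    simp only [integral_const, MeasurableSet.univ, measureReal_restrict_apply, univ_inter, smul_eq_mul, mul_one] at h
    exact h
  rw [hsplit]
  refine Finset.sum_congr rfl fun c _ => ?_
  set C : Set (BondConfig V) := {ω' : BondConfig V |
      {v : V | (openGraph (ω' \ {e : Sym2 V | s ∈ e})).Reachable y v} = c.1 ∧ ((∃ u ∈ c.1, s(s, u) ∈ ω') ↔ (c.2 = true))} with hC
  -- on `D ∩ C` the integrand is the constant `μ(D ∩ Z ∩ C)/μ(D ∩ C)`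
  rw [setIntegral_congr_fun (hmeas _) (fun ω hω => by
    rw [show {ω' : BondConfig V | {v : V | (openGraph (ω' \ {e : Sym2 V | s ∈ e})).Reachable y v} =
          {v : V | (openGraph (ω \ {e : Sym2 V | s ∈ e})).Reachable y v} ∧
        ((∃ u ∈ {v : V | (openGraph (ω \ {e : Sym2 V | s ∈ e})).Reachable y v}, s(s, u) ∈ ω') ↔
          (∃ u ∈ {v : V | (openGraph (ω \ {e : Sym2 V | s ∈ e})).Reachable y v}, s(s, u) ∈ ω))} = C from markerClass_eq_of_mem hω.2]),
    setIntegral_const, smul_eq_mul]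
  by_cases h0 : μ.real (D ∩ C) = 0
  · rw [h0, zero_mul]
    exact (measureReal_mono_null (show D ∩ openConn s z ∩ C ⊆ D ∩ C from fun ω hω => ⟨hω.1.1, hω.2⟩) h0).symm
  · field_simp

/-- **`E_ν[Cov_ν(F, 1_Z | classes)] ≥ 0`, summed: `∫_D F(C_s)·h̃ ≤ ∫_{D ∩ {s↔z}} F(C_s)`** for `D = {s↮X}`, monotone `F`, `s ≠ y`.
[cite: VandenbergHaggstromKahn2005, Thm. 1.3 (p. 6), §1 pp. 7–8] -/
theorem integral_mul_markerClassCond_le (w : Sym2 V → unitInterval) (s y z : V) (X : Set V) (hsy : s ≠ y)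
    (F : Set (Sym2 V) → ℝ) (hF : Monotone F) :
    ∫ ω in {ω : BondConfig V | ∀ x ∈ X, ¬ (openGraph ω).Reachable s x}, F (openEdgeCluster ω s) *
      ((prodBernoulli w).real ({ω : BondConfig V | ∀ x ∈ X, ¬ (openGraph ω).Reachable s x} ∩ openConn s z ∩ {ω' : BondConfig V |
        {v : V | (openGraph (ω' \ {e : Sym2 V | s ∈ e})).Reachable y v} = {v : V | (openGraph (ω \ {e : Sym2 V | s ∈ e})).Reachable y v} ∧
        ((∃ u ∈ {v : V | (openGraph (ω \ {e : Sym2 V | s ∈ e})).Reachable y v}, s(s, u) ∈ ω') ↔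
          (∃ u ∈ {v : V | (openGraph (ω \ {e : Sym2 V | s ∈ e})).Reachable y v}, s(s, u) ∈ ω))}) /
      (prodBernoulli w).real ({ω : BondConfig V | ∀ x ∈ X, ¬ (openGraph ω).Reachable s x} ∩ {ω' : BondConfig V |
        {v : V | (openGraph (ω' \ {e : Sym2 V | s ∈ e})).Reachable y v} = {v : V | (openGraph (ω \ {e : Sym2 V | s ∈ e})).Reachable y v} ∧
        ((∃ u ∈ {v : V | (openGraph (ω \ {e : Sym2 V | s ∈ e})).Reachable y v}, s(s, u) ∈ ω') ↔
          (∃ u ∈ {v : V | (openGraph (ω \ {e : Sym2 V | s ∈ e})).Reachable y v}, s(s, u) ∈ ω))})) ∂(prodBernoulli w) ≤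
    ∫ ω in {ω : BondConfig V | ∀ x ∈ X, ¬ (openGraph ω).Reachable s x} ∩ openConn s z, F (openEdgeCluster ω s) ∂(prodBernoulli w) := by
  set μ := prodBernoulli w with hμ
  have hmeas : ∀ A : Set (BondConfig V), MeasurableSet A := fun _ => MeasurableSet.of_discrete
  set D : Set (BondConfig V) := {ω | ∀ x ∈ X, ¬ (openGraph ω).Reachable s x} with hD
  rw [setIntegral_eq_sum_markerClass μ s y D, setIntegral_eq_sum_markerClass μ s y (D ∩ openConn s z)]
  refine Finset.sum_le_sum fun c _ => ?_
  set C : Set (BondConfig V) := {ω' : BondConfig V |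
      {v : V | (openGraph (ω' \ {e : Sym2 V | s ∈ e})).Reachable y v} = c.1 ∧ ((∃ u ∈ c.1, s(s, u) ∈ ω') ↔ (c.2 = true))} with hC
  rw [setIntegral_congr_fun (hmeas _) (fun ω hω => by
    rw [show {ω' : BondConfig V | {v : V | (openGraph (ω' \ {e : Sym2 V | s ∈ e})).Reachable y v} =
          {v : V | (openGraph (ω \ {e : Sym2 V | s ∈ e})).Reachable y v} ∧
        ((∃ u ∈ {v : V | (openGraph (ω \ {e : Sym2 V | s ∈ e})).Reachable y v}, s(s, u) ∈ ω') ↔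
          (∃ u ∈ {v : V | (openGraph (ω \ {e : Sym2 V | s ∈ e})).Reachable y v}, s(s, u) ∈ ω))} = C from markerClass_eq_of_mem hω.2]),
    integral_mul_const]
  -- the per-class inequality
  have key := markerClass_condCov_nonneg w s y z X hsy F hF c.1 (c.2 = true)
  have hI0 : ∀ S : Set (BondConfig V), μ.real S = 0 → ∫ ω in S, F (openEdgeCluster ω s) ∂μ = 0 := fun S hS =>
    setIntegral_measure_zero _ ((measureReal_eq_zero_iff).1 hS)
  have hsub : D ∩ openConn s z ∩ C ⊆ D ∩ C := fun ω hω => ⟨hω.1.1, hω.2⟩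
  rw [show D ∩ openConn s z ∩ C = D ∩ C ∩ openConn s z from by ext ω; simp only [mem_inter_iff]; tauto] at hsub ⊢
  by_cases h0 : μ.real (D ∩ C) = 0
  · rw [h0, div_zero, mul_zero, hI0 _ (measureReal_mono_null hsub h0)]
  · have hpos : 0 < μ.real (D ∩ C) := lt_of_le_of_ne measureReal_nonneg (Ne.symm h0)
    rw [mul_div_assoc', div_le_iff₀ hpos, mul_comm (∫ ω in D ∩ C ∩ openConn s z, F (openEdgeCluster ω s) ∂μ)]
    exact key

/-- **The marker-cluster reduction, per functional: `J_y(F) ≥ 0 ⟹ MDLX(F) ≥ 0`.**  For all weights, `s ≠ y`, `z`, `X`, and every monotone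
`F`: if `μ(T∩W)·(μ(D)·∫_{D∩Y} F − ∫_D F·μ(D∩Y)) ≤ μ(T)·(μ(D)·∫_D F·h̃ − ∫_D F·∫_D h̃)` — the inequality `J_y(F) ≥ 0` of memo §8 with
`h̃ = ν(s↔z | V(C_y[G−s]), 1_Y)` written as a quotient of class masses — then the `Consts.MDLXJoint` inequality holds at `F`
(`T = 𝒜 ∩ D`, `W = {y↔z}`, `D = {s↮X}`).  Proof: `∫_D h̃ = μ(D∩Z)` (`Consts.integral_markerClassCond_eq`) and `∫_D F·h̃ ≤ ∫_{D∩Z} F`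
(`Consts.integral_mul_markerClassCond_le`, the summed within-class positive association).
[cite: VandenbergHaggstromKahn2005, Thm. 1.3 (p. 6), §1 pp. 7–8] -/
theorem mdlxJoint_of_markerBetween (w : Sym2 V → unitInterval) (s y z : V) (X : Set V) (hsy : s ≠ y)
    (F : Set (Sym2 V) → ℝ) (hF : Monotone F)
    (hJ : (prodBernoulli w).real ({ω : BondConfig V | ∀ x ∈ insert s X, ¬ (openGraph ω).Reachable y x} ∩
          {ω : BondConfig V | ∀ x ∈ X, ¬ (openGraph ω).Reachable s x} ∩ openConn y z) *
        ((prodBernoulli w).real {ω : BondConfig V | ∀ x ∈ X, ¬ (openGraph ω).Reachable s x} *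
            ∫ ω in {ω : BondConfig V | ∀ x ∈ X, ¬ (openGraph ω).Reachable s x} ∩ openConn s y, F (openEdgeCluster ω s) ∂(prodBernoulli w) -
          (∫ ω in {ω : BondConfig V | ∀ x ∈ X, ¬ (openGraph ω).Reachable s x}, F (openEdgeCluster ω s) ∂(prodBernoulli w)) *
            (prodBernoulli w).real ({ω : BondConfig V | ∀ x ∈ X, ¬ (openGraph ω).Reachable s x} ∩ openConn s y)) ≤
      (prodBernoulli w).real ({ω : BondConfig V | ∀ x ∈ insert s X, ¬ (openGraph ω).Reachable y x} ∩
          {ω : BondConfig V | ∀ x ∈ X, ¬ (openGraph ω).Reachable s x}) *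
        ((prodBernoulli w).real {ω : BondConfig V | ∀ x ∈ X, ¬ (openGraph ω).Reachable s x} *
            ∫ ω in {ω : BondConfig V | ∀ x ∈ X, ¬ (openGraph ω).Reachable s x}, F (openEdgeCluster ω s) *
              ((prodBernoulli w).real ({ω : BondConfig V | ∀ x ∈ X, ¬ (openGraph ω).Reachable s x} ∩ openConn s z ∩ {ω' : BondConfig V |
        {v : V | (openGraph (ω' \ {e : Sym2 V | s ∈ e})).Reachable y v} = {v : V | (openGraph (ω \ {e : Sym2 V | s ∈ e})).Reachable y v} ∧
        ((∃ u ∈ {v : V | (openGraph (ω \ {e : Sym2 V | s ∈ e})).Reachable y v}, s(s, u) ∈ ω') ↔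
          (∃ u ∈ {v : V | (openGraph (ω \ {e : Sym2 V | s ∈ e})).Reachable y v}, s(s, u) ∈ ω))}) /
      (prodBernoulli w).real ({ω : BondConfig V | ∀ x ∈ X, ¬ (openGraph ω).Reachable s x} ∩ {ω' : BondConfig V |
        {v : V | (openGraph (ω' \ {e : Sym2 V | s ∈ e})).Reachable y v} = {v : V | (openGraph (ω \ {e : Sym2 V | s ∈ e})).Reachable y v} ∧
        ((∃ u ∈ {v : V | (openGraph (ω \ {e : Sym2 V | s ∈ e})).Reachable y v}, s(s, u) ∈ ω') ↔
          (∃ u ∈ {v : V | (openGraph (ω \ {e : Sym2 V | s ∈ e})).Reachable y v}, s(s, u) ∈ ω))})) ∂(prodBernoulli w) -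
          (∫ ω in {ω : BondConfig V | ∀ x ∈ X, ¬ (openGraph ω).Reachable s x}, F (openEdgeCluster ω s) ∂(prodBernoulli w)) *
            ∫ ω in {ω : BondConfig V | ∀ x ∈ X, ¬ (openGraph ω).Reachable s x}, ((prodBernoulli w).real ({ω : BondConfig V | ∀ x ∈ X, ¬ (openGraph ω).Reachable s x} ∩ openConn s z ∩ {ω' : BondConfig V |
        {v : V | (openGraph (ω' \ {e : Sym2 V | s ∈ e})).Reachable y v} = {v : V | (openGraph (ω \ {e : Sym2 V | s ∈ e})).Reachable y v} ∧
        ((∃ u ∈ {v : V | (openGraph (ω \ {e : Sym2 V | s ∈ e})).Reachable y v}, s(s, u) ∈ ω') ↔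
          (∃ u ∈ {v : V | (openGraph (ω \ {e : Sym2 V | s ∈ e})).Reachable y v}, s(s, u) ∈ ω))}) /
      (prodBernoulli w).real ({ω : BondConfig V | ∀ x ∈ X, ¬ (openGraph ω).Reachable s x} ∩ {ω' : BondConfig V |
        {v : V | (openGraph (ω' \ {e : Sym2 V | s ∈ e})).Reachable y v} = {v : V | (openGraph (ω \ {e : Sym2 V | s ∈ e})).Reachable y v} ∧
        ((∃ u ∈ {v : V | (openGraph (ω \ {e : Sym2 V | s ∈ e})).Reachable y v}, s(s, u) ∈ ω') ↔
          (∃ u ∈ {v : V | (openGraph (ω \ {e : Sym2 V | s ∈ e})).Reachable y v}, s(s, u) ∈ ω))})) ∂(prodBernoulli w))) :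
    (prodBernoulli w).real ({ω : BondConfig V | ∀ x ∈ insert s X, ¬ (openGraph ω).Reachable y x} ∩
          {ω : BondConfig V | ∀ x ∈ X, ¬ (openGraph ω).Reachable s x} ∩ openConn y z) *
        ((prodBernoulli w).real {ω : BondConfig V | ∀ x ∈ X, ¬ (openGraph ω).Reachable s x} *
            ∫ ω in {ω : BondConfig V | ∀ x ∈ X, ¬ (openGraph ω).Reachable s x} ∩ openConn s y, F (openEdgeCluster ω s) ∂(prodBernoulli w) -
          (∫ ω in {ω : BondConfig V | ∀ x ∈ X, ¬ (openGraph ω).Reachable s x}, F (openEdgeCluster ω s) ∂(prodBernoulli w)) *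
            (prodBernoulli w).real ({ω : BondConfig V | ∀ x ∈ X, ¬ (openGraph ω).Reachable s x} ∩ openConn s y)) ≤
      (prodBernoulli w).real ({ω : BondConfig V | ∀ x ∈ insert s X, ¬ (openGraph ω).Reachable y x} ∩
          {ω : BondConfig V | ∀ x ∈ X, ¬ (openGraph ω).Reachable s x}) *
        ((prodBernoulli w).real {ω : BondConfig V | ∀ x ∈ X, ¬ (openGraph ω).Reachable s x} *
            ∫ ω in {ω : BondConfig V | ∀ x ∈ X, ¬ (openGraph ω).Reachable s x} ∩ openConn s z, F (openEdgeCluster ω s) ∂(prodBernoulli w) -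
          (∫ ω in {ω : BondConfig V | ∀ x ∈ X, ¬ (openGraph ω).Reachable s x}, F (openEdgeCluster ω s) ∂(prodBernoulli w)) *
            (prodBernoulli w).real ({ω : BondConfig V | ∀ x ∈ X, ¬ (openGraph ω).Reachable s x} ∩ openConn s z)) := by
  have h1 := integral_markerClassCond_eq w s y z {ω : BondConfig V | ∀ x ∈ X, ¬ (openGraph ω).Reachable s x}
  have h2 := integral_mul_markerClassCond_le w s y z X hsy F hF
  rw [h1] at hJ
  refine hJ.trans (mul_le_mul_of_nonneg_left ?_ measureReal_nonneg)
  exact sub_le_sub_right (mul_le_mul_of_nonneg_left h2 measureReal_nonneg) _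

end Consts

end Summit.CriticalPhenomena.PercolationContinuityZ3.Theorems

end
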